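import Mathlib
import Literature.Computability.Complexity.CircuitClassesProofs
import Literature.Computability.Complexity.CircuitLowerBounds
import Literature.Computability.Complexity.CookBridges
import Literature.Computability.Complexity.HamMatrixCircuits
import Literature.ModelTheory.FiniteModelTheory.ESOVerifier
import Summits.PneNP.PneNP.Theorems.PositionalGamesMpgHardNpLanguageQuery
import Summits.PneNP.PneNP.Theorems.PositionalGamesMpgHardNpLanguageComplete
import Summits.PneNP.PneNP.Theses.PositionalGames

/-!
# Route PositionalGames — support item `MpgHardNpLanguage` (stmt-PneNP-1300), proved

`Summit.PneNP.PneNP.Theses.PositionalGames.MpgHardNpLanguage`: there is a language `L ∈ NP`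
(`Literature.Computability.Complexity.Nondeterministic.NP`, certificates over Cook's `P`) such
that `L ∈ P/poly` forces polynomial-size `B₂`-circuits for the winning predicate of EVERY
threshold mean-payoff template, `∃ c, ∀ᶠ n, ∀ o v, circuitSizeOver B2 (MPGWIN n o v) ≤ n ^ c`
(the construction carrying the route's thesis `MpgGeneralSuperpoly` to the summit through the
deciding theorem `closes`).

The witness is the language of codes (`encodingSNPInstance`, `CodeLayout.codeOf`) of the finite
models of an `∃SO` sentence `Φ` over the game vocabulary `inVocab` of `…Defs.lean`:

* `Φ` exists with model class `classOf mpgQuery` (`isESODefinable_mpg`, `…Query.lean`: the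
  certificate check is first-order), so `Φ.language ∈ NP` by FAGIN'S EASY DIRECTION, PROVED in the
  tree (`eso_subset_NP_holds`, `ESOVerifier.lean`; `inVocab` is non-degenerate);
* a game `(n, o, v)` with input `x` is the structure `gameTab n o v x` on `Fin (2n+2)`
  (`…Defs.lean`), and `code x ∈ Φ.language ↔` some witness tables pass the check
  `↔ MpgWin n o v x` (`exists_mpgQ_iff`, `…Semantics.lean`/`…Complete.lean`: potentials certify
  Even's win, Zwick–Paterson 1996 §2), `MpgWin` being VERBATIM the route's inline predicate;
* every bit of that code is a constant (header, separators, the tables `IsV, Ow, St, PN, LT`, the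
  off-range entries) or one input bit `x i` (tables `Ed`, `W2`) — `codeBit_shape`, by the layout
  lemmas of `CodeLayout.lean` — so a polynomial-size circuit family for `Φ.language`, composed with
  these `N(n) ≤ 12n² + 36n + 28` free wires (`CktSize` calculus of `CircuitComposition.lean`, as in
  `HamMatrixCircuits.polySize_B2_of_mem_PPoly`), is a `B₂`-circuit for `x ↦ MPGWIN n o v x` of size
  `≤ q(n) ≤ n ^ k` for `n ≥ 2` (`CookBridges.exists_pow_dominates`), uniformly in `(o, v)`.

Unconditional: no named fact is assumed.
-/

namespace Summit.PneNP.PneNP.Theorems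

set_option linter.dupNamespace false -- `Summit.PneNP.PneNP.…`: summit = sub-problem (D-0017)

namespace MpgNP

open Literature.ModelTheory.FiniteModelTheory Literature.Computability.Cryptography
open Literature.Computability.Complexity Finset Filter Polynomial
open _root_.Computability

variable {n : ℕ}

/-! ### The bits of the code of a game -/

section Code

variable (o : Fin n → Bool) (v : Fin n)

/-- **Every table entry is a constant or an input bit.** [folklore] -/
theorem tab_shape : ∀ (s : Fin inVocab.length) (t : Fin (inVocab.get s) → Fin (usize n)),
    (∃ b, ∀ x, gameTab n o v x s t = b) ∨ (∃ i, ∀ x, gameTab n o v x s t = x i)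
  | ⟨0, _⟩, t => Or.inl ⟨_, fun _ => rfl⟩
  | ⟨1, _⟩, t => Or.inl ⟨_, fun _ => rfl⟩
  | ⟨2, _⟩, t => Or.inl ⟨_, fun _ => rfl⟩
  | ⟨3, _⟩, t => by
      by_cases ha : (t (Fin.cast rfl (0 : Fin 2)) : ℕ) < n
      · by_cases hb : (t (Fin.cast rfl (1 : Fin 2)) : ℕ) < n
        · refine Or.inr ⟨Sum.inl (⟨_, ha⟩, ⟨_, hb⟩), fun x => ?_⟩
          show (if ha : (t (Fin.cast rfl (0 : Fin 2)) : ℕ) < n then (if hb : (t (Fin.cast rfl (1 : Fin 2)) : ℕ) < n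
            then x (Sum.inl (⟨_, ha⟩, ⟨_, hb⟩)) else false) else false) = _
          rw [dif_pos ha, dif_pos hb]
        · refine Or.inl ⟨false, fun x => ?_⟩
          show (if ha : (t (Fin.cast rfl (0 : Fin 2)) : ℕ) < n then (if hb : (t (Fin.cast rfl (1 : Fin 2)) : ℕ) < n
            then x (Sum.inl (⟨_, ha⟩, ⟨_, hb⟩)) else false) else false) = _
          rw [dif_pos ha, dif_neg hb]
      · refine Or.inl ⟨false, fun x => ?_⟩
        show (if ha : (t (Fin.cast rfl (0 : Fin 2)) : ℕ) < n then (if hb : (t (Fin.cast rfl (1 : Fin 2)) : ℕ) < n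
          then x (Sum.inl (⟨_, ha⟩, ⟨_, hb⟩)) else false) else false) = _
        rw [dif_neg ha]
  | ⟨4, _⟩, t => by
      by_cases ha : (t (Fin.cast rfl (0 : Fin 2)) : ℕ) < n
      · by_cases hj : 1 ≤ (t (Fin.cast rfl (1 : Fin 2)) : ℕ) ∧ (t (Fin.cast rfl (1 : Fin 2)) : ℕ) ≤ n
        · refine Or.inr ⟨Sum.inr (⟨_, ha⟩, ⟨(t (Fin.cast rfl (1 : Fin 2)) : ℕ) - 1, by omega⟩), fun x => ?_⟩
          show (if ha : (t (Fin.cast rfl (0 : Fin 2)) : ℕ) < n then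
            (if hj : 1 ≤ (t (Fin.cast rfl (1 : Fin 2)) : ℕ) ∧ (t (Fin.cast rfl (1 : Fin 2)) : ℕ) ≤ n then
              x (Sum.inr (⟨_, ha⟩, ⟨(t (Fin.cast rfl (1 : Fin 2)) : ℕ) - 1, by omega⟩)) else false) else false) = _
          rw [dif_pos ha, dif_pos hj]
        · refine Or.inl ⟨false, fun x => ?_⟩
          show (if ha : (t (Fin.cast rfl (0 : Fin 2)) : ℕ) < n then
            (if hj : 1 ≤ (t (Fin.cast rfl (1 : Fin 2)) : ℕ) ∧ (t (Fin.cast rfl (1 : Fin 2)) : ℕ) ≤ n then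
              x (Sum.inr (⟨_, ha⟩, ⟨(t (Fin.cast rfl (1 : Fin 2)) : ℕ) - 1, by omega⟩)) else false) else false) = _
          rw [dif_pos ha, dif_neg hj]
      · refine Or.inl ⟨false, fun x => ?_⟩
        show (if ha : (t (Fin.cast rfl (0 : Fin 2)) : ℕ) < n then
          (if hj : 1 ≤ (t (Fin.cast rfl (1 : Fin 2)) : ℕ) ∧ (t (Fin.cast rfl (1 : Fin 2)) : ℕ) ≤ n then
            x (Sum.inr (⟨_, ha⟩, ⟨(t (Fin.cast rfl (1 : Fin 2)) : ℕ) - 1, by omega⟩)) else false) else false) = _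
        rw [dif_neg ha]
  | ⟨5, _⟩, t => Or.inl ⟨_, fun _ => rfl⟩
  | ⟨6, _⟩, t => Or.inl ⟨_, fun _ => rfl⟩

/-- **Every bit of the code is a constant or an input bit** (header, separators and five tables
are fixed by `(n, o, v)`; `Ed`, `W2` copy input bits). [cite: Libkin2004, (6.1)] -/
theorem codeBit_shape (j : Fin (codeLenG n)) :
    (∃ b, ∀ x, codeBitG o v j x = b) ∨ (∃ i, ∀ x, codeBitG o v j x = x i) := by
  -- read position `j` through the layout lemmas
  have key : ∀ (x : (Fin n × Fin n) ⊕ (Fin n × Fin n) → Bool) (b : Bool),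
      (codeOf (gameTab n o v x))[(j : ℕ)]? = some b → codeBitG o v j x = b := fun x b h =>
    Option.some_injective _ (by rw [← h, codeBitG, List.getElem?_eq_getElem])
  by_cases h1 : (j : ℕ) < 2 * Nat.size (usize n)
  · exact Or.inl ⟨_, fun x => key x _ (getElem?_codeOf_header (gameTab n o v x) h1)⟩
  by_cases h2 : (j : ℕ) = 2 * Nat.size (usize n)
  · exact Or.inl ⟨false, fun x => key x _ (by rw [h2]; exact getElem?_codeOf_sep0 (gameTab n o v x))⟩
  by_cases h3 : (j : ℕ) = 2 * Nat.size (usize n) + 1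
  · exact Or.inl ⟨true, fun x => key x _ (by rw [h3]; exact getElem?_codeOf_sep1 (gameTab n o v x))⟩
  -- a table position
  obtain ⟨k, hk⟩ : ∃ k, (j : ℕ) = 2 * Nat.size (usize n) + 2 + k :=
    ⟨(j : ℕ) - (2 * Nat.size (usize n) + 2), by omega⟩
  have hkt : k < tableBits inVocab (usize n) := by have := j.2; unfold codeLenG at this; omega
  have hval : ∀ x, codeBitG o v j x =
      gameTab n o v x (finSigmaFinEquiv.symm ⟨k, hkt⟩ : Σ i : Fin inVocab.length, Fin (usize n ^ inVocab.get i)).1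
        (finFunctionFinEquiv.symm
          (finSigmaFinEquiv.symm ⟨k, hkt⟩ : Σ i : Fin inVocab.length, Fin (usize n ^ inVocab.get i)).2) :=
    fun x => key x _ (by rw [hk, getElem?_codeOf_table (gameTab n o v x) hkt, relTablesEquiv_apply]; rfl)
  rcases tab_shape o v _ (finFunctionFinEquiv.symm
      (finSigmaFinEquiv.symm ⟨k, hkt⟩ : Σ i : Fin inVocab.length, Fin (usize n ^ inVocab.get i)).2) with
    ⟨b, hb⟩ | ⟨i, hi⟩
  · exact Or.inl ⟨b, fun x => (hval x).trans (hb x)⟩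
  · exact Or.inr ⟨i, fun x => (hval x).trans (hi x)⟩

/-- Each code bit costs at most one gate. [folklore] -/
theorem cktSize_codeBitG (j : Fin (codeLenG n)) :
    CktSize B2 (fun (x : (Fin n × Fin n) ⊕ (Fin n × Fin n) → Bool) (_ : Unit) => codeBitG o v j x) 1 := by
  rcases codeBit_shape o v j with ⟨b, hb⟩ | ⟨i, hi⟩
  · exact (cktSize_const _ b).congr fun x _ => (hb x).symm
  · exact ((CktSize.proj B2 fun _ : Unit => i).of_le (Nat.zero_le 1)).congr fun x _ => (hi x).symm

/-- All code bits together: `codeLenG n` gates. [folklore] -/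
theorem cktSize_codeBits :
    CktSize B2 (fun (x : (Fin n × Fin n) ⊕ (Fin n × Fin n) → Bool) (j : Fin (codeLenG n)) => codeBitG o v j x)
      (codeLenG n) := by
  simpa using CktSize.pi_const (B := B2) (κ := Fin (codeLenG n)) (s := 1) (fun j => cktSize_codeBitG o v j)

end Code

/-! ### The code length is polynomial -/

/-- `tableBits inVocab m = 4m + 3m²`. [folklore] -/
theorem tableBits_inVocab (m : ℕ) : tableBits inVocab m = 4 * m + 3 * m ^ 2 := by
  rw [tableBits_eq_sum_map]
  simp
  ring

/-- `codeLenG n ≤ 12n² + 36n + 28`. [folklore] -/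
theorem codeLenG_le (n : ℕ) : codeLenG n ≤ (12 * X ^ 2 + 36 * X + 28 : Polynomial ℕ).eval n := by
  have hs : Nat.size (usize n) ≤ usize n + 1 := by
    rw [← TM2Pass.length_encodeNat_eq_size]; exact TM2Pass.length_encodeNat_le_self _
  simp only [eval_add, eval_mul, eval_pow, eval_X, eval_ofNat]
  unfold codeLenG
  rw [tableBits_inVocab]
  unfold usize at *
  nlinarith

/-! ### From `P/poly` to circuits for every template -/

open scoped Classical in
/-- Membership of the code in the language of `Φ` is the route's winning predicate.
[cite: Fagin1974, §2] -/
theorem code_mem_language_iff (Φ : ESOSentence inVocab) (hΦ : Φ.modelClass = classOf mpgQuery)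
    (o : Fin n → Bool) (v : Fin n) (x : (Fin n × Fin n) ⊕ (Fin n × Fin n) → Bool) :
    codeOf (gameTab n o v x) ∈ Φ.language ↔ MpgWin n o v x := by
  rw [codeOf, ESOSentence.encode_mem_language_iff]
  change (⟨usize n, gameTab n o v x⟩ : SNPInstance inVocab) ∈ Φ.modelClass ↔ _
  rw [hΦ, mem_classOf_iff]
  exact exists_mpgQ_iff o v x

/-- **String circuits give template circuits.** If the language of `Φ` (model class = the
certificate check) is in `P/poly`, then for `n ≥ 2` every template `(o, v)` has a `B₂`-circuit
for `x ↦ MPGWIN n o v x` of size `≤ n ^ k`, one `k` for all (for any decidability instances used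
to read the predicate as a Boolean function). [cite: AroraBarak2009, Def. 6.5 and §0.1] -/
theorem circuits_of_mem_PPoly (Φ : ESOSentence inVocab) (hΦ : Φ.modelClass = classOf mpgQuery)
    (hL : Φ.language ∈ PPoly) :
    ∃ c : ℕ, ∀ᶠ n : ℕ in atTop, ∀ (o : Fin n → Bool) (v : Fin n)
      (dec : ∀ x : (Fin n × Fin n) ⊕ (Fin n × Fin n) → Bool, Decidable (MpgWin n o v x)),
      circuitSizeOver B2 (fun x : (Fin n × Fin n) ⊕ (Fin n × Fin n) → Bool =>
        @decide (MpgWin n o v x) (dec x)) ≤ n ^ c := by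
  obtain ⟨p, hp⟩ := Set.mem_iUnion.1 hL
  obtain ⟨D, hD, hdec⟩ := hp
  let Nq : Polynomial ℕ := 12 * X ^ 2 + 36 * X + 28
  obtain ⟨k, -, hk⟩ := CookBridges.exists_pow_dominates (Nq + p.comp Nq)
  refine ⟨k, eventually_atTop.2 ⟨2, fun n hn o v dec => ?_⟩⟩
  set N := codeLenG n with hN
  have hcomp := (cktSize_codeBits o v).comp (Circuit.cktSize_eval (D N) (hD N).1)
  -- the composite computes the winning predicate
  have hval : ∀ x, (D N).eval (fun j : Fin N => codeBitG o v j x) = @decide (MpgWin n o v x) (dec x) := by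
    intro x
    have h1 : (D N).eval (fun j : Fin N => codeBitG o v j x) =
        (Φ.language).boolIndicator (codeOf (gameTab n o v x)) := by
      rw [← hdec, ← HamMatrix.eval_family_cast D _ (length_code o v x)]
      rfl
    rw [h1]
    have hiff := code_mem_language_iff Φ hΦ o v x
    by_cases hH : MpgWin n o v x
    · rw [decide_eq_true hH]
      exact (Set.mem_iff_boolIndicator _ _).1 (hiff.2 hH)
    · rw [decide_eq_false hH, Bool.eq_false_iff]
      exact fun h => hH (hiff.1 ((Set.mem_iff_boolIndicator _ _).2 h))
  obtain ⟨C, hCB, hCs, hCe⟩ := (hcomp.congr fun x _ => hval x).toCircuit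
  refine (circuitSizeOver_le_of_computes C hCB hCe).trans (hCs.trans ?_)
  -- size bookkeeping: `N + p N ≤ (Nq + p ∘ Nq)(n) ≤ n ^ k`
  have hNq : N ≤ Nq.eval n := codeLenG_le n
  have hk' := hk n hn
  rw [eval_add, eval_comp] at hk'
  exact (Nat.add_le_add hNq (((hD N).2).trans (natPoly_eval_mono p hNq))).trans hk'

end MpgNP

/-! ### The item -/

open Literature.ModelTheory.FiniteModelTheory Literature.Computability.Complexity in
/-- **`MpgHardNpLanguage` (stmt-PneNP-1300) holds**: the language of codes of the finite models
of the `∃SO` certificate sentence for threshold mean-payoff games is in `NP` (Fagin's easy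
direction, proved in the tree) and, if it is in `P/poly`, every template `(o, v)` of every size
`n ≥ 2` has a `B₂`-circuit for `x ↦ MPGWIN n o v x` of size `≤ n ^ c`, one `c` for all.
[cite: ZwickPaterson1996, §2 (MPG decision problem in NP ∩ coNP)] -/
theorem mpgHardNpLanguage_proof : Summit.PneNP.PneNP.Theses.PositionalGames.MpgHardNpLanguage := by
  unfold Summit.PneNP.PneNP.Theses.PositionalGames.MpgHardNpLanguage
  obtain ⟨Φ, hΦ⟩ := MpgNP.isESODefinable_mpg
  refine ⟨Φ.language, eso_subset_NP_holds MpgNP.inVocab ⟨1, by simp, le_rfl⟩ Φ, fun hL => ?_⟩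
  obtain ⟨c, hc⟩ := MpgNP.circuits_of_mem_PPoly Φ hΦ hL
  exact ⟨c, hc.mono fun n hn o v => hn o v _⟩

end Summit.PneNP.PneNP.Theorems
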